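import Mathlib
import HarnessLib
import Summits.HubbardSuperconductivity.HubbardSuperconductivity.Theorems.KLProgrammeKLRegimeVolumeLimitSunsetFrameRate
import Summits.HubbardSuperconductivity.HubbardSuperconductivity.Theorems.KLProgrammeKLRegimeVolumeLimitSecondOrderLimit

/-!
# Route `KLProgramme` — VL child `KLRegimeVolumeLimitV12` (stmt-HubbardSuperconductivity-19858), Cauchy stub `stub_vl_twoVolumeRate`:
# the order-`U²` rung of the TRUE carrier, PART 1/2 — the two continuum SYMBOLS of the rung (bare propagator `ĝ₀`, frame dressing
# `ĝ₀/ĝ_K = 1 − K·ĝ₀`) with their bounds / torus-periodicity / Lipschitz moduli, and the carrier's first two `U`-derivatives at `U = 0`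
# written in these symbols (cell gate-hubbard-kl, seat hubbard-kl-k3c4-p1 g4; PART 2/2 = `…VolumeLimitSecondOrderRate`)

The k3c5 lane evaluated the first two coupling derivatives of the VL carrier `Σ̂^K_{L,M}(k,σ;U) = klSelfEnergy L M β U μ K klE0 (nScales β + 1) k σ`
at `U = 0` (`hasDerivAt_klSelfEnergy_nScales_succ_zero_hartree`, `hasDerivAt_deriv_klSelfEnergy_nScales_succ_zero_eval`):
`S₁ = −(ĝ₀/ĝ_K)²·t`, `S₂ = 2(ĝ₀/ĝ_K)²·(Sun/(βL²)² − ĝ₀·t² − t·t₂)` with the tadpole average `t = (βL²)⁻¹Σ_q ĝ₀(q)`, the one-loop average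
`t₂ = (βL²)⁻¹Σ_q ĝ₀(q)²` and the sunset sum `Sun/(βL²)² = klSunset L M β ĝ₀` (`sunsetSum_div_eq_klSunset`).  For the CAUCHY form of the
order-`U²` rung (two volumes, cross-grid torus modulus) the momentum-dependent factors must be read as grid samples of `L`-independent
`2π`-periodic Lipschitz symbols.  This file provides exactly that:

* §1 the bare symbol `g₀(n,p) = (ξ(p) − iω_n)⁻¹`: periodic (in the `p + 2πm` convention of the rate algebra), `‖g₀‖ ≤ β/π`,
  `‖g₀(n,x) − g₀(n,y)‖ ≤ (4β²/π²)‖x − y‖_∞` (`klso_bareSymbol_*`, from `…SunsetFrameRate.klfr_bareSymbol_sub_le`);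
* §2 the frame under `FrameOK`: `|K(x) − K(y)| ≤ (4 + 7√2)‖x − y‖_∞` (`klso_abs_eval_sub_le`: `K = ξ − e_K` and both bands are Lipschitz);
  the dressing symbol `d(n,p) = 1 − K(p)·g₀(n,p)` and its square: periodic, `‖d‖ ≤ 1 + ‖K‖₀β/π`, Lipschitz `(4+7√2)β/π + ‖K‖₀·4β²/π²`
  (`klso_dress_*`, `klso_dressSq_*`);
* §3 grid dictionary and the derivatives in symbol form: `propCT … 0 (ω,k) = g₀(n,p_k)`, `propCT … 0/propCT … K = d(n,p_k)`
  (`klso_propCT_div_eq_dress`), **`klso_deriv_eq`** (`S₁ = −d(n,p_k)²·t`) and **`klso_deriv_deriv_eq`**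
  (`S₂ = 2·d(n,p_k)²·(klSunset L M β g₀ (ω,k) σ − g₀(n,p_k)·t² − t·t₂)`).

Nothing new is asserted about the model beyond the k3c5 lane's identities; PART 2/2 assembles the two-volume rate.
-/

noncomputable section

namespace Summit.HubbardSuperconductivity.HubbardSuperconductivity.Theorems.KLRegimeSplit

set_option linter.dupNamespace false -- summit = problem name (single-conjunct summit), D-0017

open Filter Topology Finset Real Literature.MathematicalPhysics.QuantumLattice Literature.Probability.LatticeModels
open Literature.MathematicalPhysics.QuantumLattice.FermiRG
open Summit.HubbardSuperconductivity.HubbardSuperconductivity.Theorems.DispersionFlow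
open Summit.HubbardSuperconductivity.HubbardSuperconductivity.Theorems.KLProgrammeLegKernels
open Summit.HubbardSuperconductivity.HubbardSuperconductivity.Theorems.TwoPointAssembly

/-! ## §1 The bare symbol `g₀(n,p) = (ξ(p) − iω_n)⁻¹` -/

/-- Periodicity of the bare band in the `p + m·2π` convention of the rate algebra. -/
theorem klso_bandCT_periodic' (μ : ℝ) (K : TrigPolyC4v) (p : Fin 2 → ℝ) (m : Fin 2 → ℤ) :
    bandCT μ K (fun i => p i + m i * (2 * Real.pi)) = bandCT μ K p := by
  have h : (fun i => p i + m i * (2 * Real.pi)) = fun i => p i + 2 * π * (m i : ℝ) := by funext i; ring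
  rw [h, klfs_bandCT_periodic]

/-- **Periodicity of the bare symbol** (`p + m·2π` convention). -/
theorem klso_bareSymbol_periodic (β μ : ℝ) (n : ℤ) (p : Fin 2 → ℝ) (m : Fin 2 → ℤ) :
    ((bandCT μ 0 (fun i => p i + m i * (2 * Real.pi)) : ℂ) - Complex.I * (fermiMatsubara β n : ℂ))⁻¹ =
      ((bandCT μ 0 p : ℂ) - Complex.I * (fermiMatsubara β n : ℂ))⁻¹ := by
  rw [klso_bandCT_periodic']

/-- **The bare symbol is `(4β²/π²)`-Lipschitz** for the sup norm, uniformly in the label (`(2β²/π²)/|n+½|` and `|n+½| ≥ ½`). -/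
theorem klso_bareSymbol_sub_le {β : ℝ} (hβ : 0 < β) (μ : ℝ) (n : ℤ) (x y : Fin 2 → ℝ) :
    ‖((bandCT μ 0 x : ℂ) - Complex.I * (fermiMatsubara β n : ℂ))⁻¹ -
        ((bandCT μ 0 y : ℂ) - Complex.I * (fermiMatsubara β n : ℂ))⁻¹‖ ≤ 4 * β ^ 2 / π ^ 2 * ‖x - y‖ := by
  have h := klfr_bareSymbol_sub_le hβ μ n x y
  have hn := half_le_abs_int_add_half n
  have hpos : (0 : ℝ) < |(n : ℝ) + 1 / 2| := by linarith
  refine h.trans (mul_le_mul_of_nonneg_right ?_ (norm_nonneg _))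
  rw [div_le_iff₀ hpos]
  have hb : 0 ≤ 4 * β ^ 2 / π ^ 2 := by positivity
  calc 2 * β ^ 2 / π ^ 2 = 4 * β ^ 2 / π ^ 2 * (1 / 2) := by ring
    _ ≤ 4 * β ^ 2 / π ^ 2 * |(n : ℝ) + 1 / 2| := mul_le_mul_of_nonneg_left hn hb

/-! ## §2 The frame and the dressing symbol `d(n,p) = 1 − K(p)·g₀(n,p)` -/

section Frame

variable {R : RenConsts} {U : ℝ} {N : ℕ} {μ : ℝ} {K : TrigPolyC4v}

/-- **An admissible frame is `(4 + 7√2)`-Lipschitz** for the sup norm: `K = ξ − e_K` with `ξ` `4`-Lipschitz and `e_K` `7√2`-Lipschitz. -/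
theorem klso_abs_eval_sub_le (hK : FrameOK R U N μ K) (x y : Fin 2 → ℝ) :
    |K.eval x - K.eval y| ≤ (4 + 7 * Real.sqrt 2) * ‖x - y‖ := by
  have hKx : K.eval x = bandCT μ 0 x - bandCT μ K x := by simp [bandCT, TrigPolyC4v.eval_zero]
  have hKy : K.eval y = bandCT μ 0 y - bandCT μ K y := by simp [bandCT, TrigPolyC4v.eval_zero]
  rw [hKx, hKy, show bandCT μ 0 x - bandCT μ K x - (bandCT μ 0 y - bandCT μ K y) =
    (bandCT μ 0 x - bandCT μ 0 y) - (bandCT μ K x - bandCT μ K y) by ring]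
  calc |bandCT μ 0 x - bandCT μ 0 y - (bandCT μ K x - bandCT μ K y)|
      ≤ |bandCT μ 0 x - bandCT μ 0 y| + |bandCT μ K x - bandCT μ K y| := abs_sub _ _
    _ ≤ 4 * ‖x - y‖ + 7 * Real.sqrt 2 * ‖x - y‖ := add_le_add (klfr_abs_bandCT_zero_sub_le μ x y) (klfr_abs_bandCT_sub_le hK x y)
    _ = (4 + 7 * Real.sqrt 2) * ‖x - y‖ := by ring

/-- Periodicity of the dressing symbol (`p + m·2π` convention). -/
theorem klso_dress_periodic (β μ : ℝ) (K : TrigPolyC4v) (n : ℤ) (p : Fin 2 → ℝ) (m : Fin 2 → ℤ) :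
    (1 : ℂ) - (K.eval (fun i => p i + m i * (2 * Real.pi)) : ℂ) *
        ((bandCT μ 0 (fun i => p i + m i * (2 * Real.pi)) : ℂ) - Complex.I * (fermiMatsubara β n : ℂ))⁻¹ =
      1 - (K.eval p : ℂ) * ((bandCT μ 0 p : ℂ) - Complex.I * (fermiMatsubara β n : ℂ))⁻¹ := by
  rw [TrigPolyC4v.eval_periodic, klso_bandCT_periodic']

/-- **Size of the dressing symbol**: `‖1 − K(p)g₀(n,p)‖ ≤ 1 + ‖K‖₀·β/π`. -/
theorem klso_dress_norm_le {β : ℝ} (hβ : 0 < β) (μ : ℝ) (K : TrigPolyC4v) (n : ℤ) (p : Fin 2 → ℝ) :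
    ‖(1 : ℂ) - (K.eval p : ℂ) * ((bandCT μ 0 p : ℂ) - Complex.I * (fermiMatsubara β n : ℂ))⁻¹‖ ≤
      1 + K.coeffNorm 0 * (β / Real.pi) := by
  have hg := norm_bareSymbol_le hβ μ n p
  have hKp := TrigPolyC4v.abs_eval_le_coeffNorm K p
  have hK0 := TrigPolyC4v.coeffNorm_nonneg 0 K
  calc _ ≤ ‖(1 : ℂ)‖ + ‖(K.eval p : ℂ) * ((bandCT μ 0 p : ℂ) - Complex.I * (fermiMatsubara β n : ℂ))⁻¹‖ := norm_sub_le _ _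
    _ = 1 + |K.eval p| * ‖((bandCT μ 0 p : ℂ) - Complex.I * (fermiMatsubara β n : ℂ))⁻¹‖ := by
        rw [norm_one, norm_mul, Complex.norm_real, Real.norm_eq_abs]
    _ ≤ 1 + K.coeffNorm 0 * (β / Real.pi) := by
        gcongr 1 + ?_
        exact mul_le_mul hKp hg (norm_nonneg _) hK0

/-- **Lipschitz modulus of the dressing symbol** under `FrameOK`:
`‖d(n,x) − d(n,y)‖ ≤ ((4+7√2)·β/π + ‖K‖₀·4β²/π²)·‖x − y‖_∞`. -/
theorem klso_dress_sub_le {β : ℝ} (hβ : 0 < β) (hK : FrameOK R U N μ K) (n : ℤ) (x y : Fin 2 → ℝ) :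
    ‖((1 : ℂ) - (K.eval x : ℂ) * ((bandCT μ 0 x : ℂ) - Complex.I * (fermiMatsubara β n : ℂ))⁻¹) -
        ((1 : ℂ) - (K.eval y : ℂ) * ((bandCT μ 0 y : ℂ) - Complex.I * (fermiMatsubara β n : ℂ))⁻¹)‖ ≤
      ((4 + 7 * Real.sqrt 2) * (β / Real.pi) + K.coeffNorm 0 * (4 * β ^ 2 / π ^ 2)) * ‖x - y‖ := by
  set gx : ℂ := ((bandCT μ 0 x : ℂ) - Complex.I * (fermiMatsubara β n : ℂ))⁻¹ with hgx
  set gy : ℂ := ((bandCT μ 0 y : ℂ) - Complex.I * (fermiMatsubara β n : ℂ))⁻¹ with hgy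
  have hgxn : ‖gx‖ ≤ β / Real.pi := norm_bareSymbol_le hβ μ n x
  have hgxy : ‖gx - gy‖ ≤ 4 * β ^ 2 / π ^ 2 * ‖x - y‖ := klso_bareSymbol_sub_le hβ μ n x y
  have hKxy := klso_abs_eval_sub_le hK x y
  have hKy := TrigPolyC4v.abs_eval_le_coeffNorm K y
  have hK0 := TrigPolyC4v.coeffNorm_nonneg 0 K
  have hsplit : ((1 : ℂ) - (K.eval x : ℂ) * gx) - ((1 : ℂ) - (K.eval y : ℂ) * gy) =
      -(((K.eval x : ℂ) - (K.eval y : ℂ)) * gx + (K.eval y : ℂ) * (gx - gy)) := by ring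
  rw [hsplit, norm_neg]
  calc ‖((K.eval x : ℂ) - (K.eval y : ℂ)) * gx + (K.eval y : ℂ) * (gx - gy)‖
      ≤ ‖((K.eval x : ℂ) - (K.eval y : ℂ)) * gx‖ + ‖(K.eval y : ℂ) * (gx - gy)‖ := norm_add_le _ _
    _ = |K.eval x - K.eval y| * ‖gx‖ + |K.eval y| * ‖gx - gy‖ := by
        rw [norm_mul, norm_mul, ← Complex.ofReal_sub, Complex.norm_real, Complex.norm_real, Real.norm_eq_abs, Real.norm_eq_abs]
    _ ≤ (4 + 7 * Real.sqrt 2) * ‖x - y‖ * (β / Real.pi) + K.coeffNorm 0 * (4 * β ^ 2 / π ^ 2 * ‖x - y‖) :=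
        add_le_add (mul_le_mul hKxy hgxn (norm_nonneg _) (by positivity)) (mul_le_mul hKy hgxy (norm_nonneg _) hK0)
    _ = ((4 + 7 * Real.sqrt 2) * (β / Real.pi) + K.coeffNorm 0 * (4 * β ^ 2 / π ^ 2)) * ‖x - y‖ := by ring

/-- Size of the squared dressing symbol: `‖d²‖ ≤ (1 + ‖K‖₀β/π)²`. -/
theorem klso_dressSq_norm_le {β : ℝ} (hβ : 0 < β) (μ : ℝ) (K : TrigPolyC4v) (n : ℤ) (p : Fin 2 → ℝ) :
    ‖((1 : ℂ) - (K.eval p : ℂ) * ((bandCT μ 0 p : ℂ) - Complex.I * (fermiMatsubara β n : ℂ))⁻¹) ^ 2‖ ≤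
      (1 + K.coeffNorm 0 * (β / Real.pi)) ^ 2 := by
  rw [norm_pow]
  exact pow_le_pow_left₀ (norm_nonneg _) (klso_dress_norm_le hβ μ K n p) 2

/-- **Lipschitz modulus of the squared dressing symbol** under `FrameOK`: `‖d(x)² − d(y)²‖ ≤ 2·Bd·Ld·‖x − y‖_∞`. -/
theorem klso_dressSq_sub_le {β : ℝ} (hβ : 0 < β) (hK : FrameOK R U N μ K) (n : ℤ) (x y : Fin 2 → ℝ) :
    ‖((1 : ℂ) - (K.eval x : ℂ) * ((bandCT μ 0 x : ℂ) - Complex.I * (fermiMatsubara β n : ℂ))⁻¹) ^ 2 -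
        ((1 : ℂ) - (K.eval y : ℂ) * ((bandCT μ 0 y : ℂ) - Complex.I * (fermiMatsubara β n : ℂ))⁻¹) ^ 2‖ ≤
      2 * (1 + K.coeffNorm 0 * (β / Real.pi)) * ((4 + 7 * Real.sqrt 2) * (β / Real.pi) + K.coeffNorm 0 * (4 * β ^ 2 / π ^ 2)) *
        ‖x - y‖ := by
  set dx : ℂ := (1 : ℂ) - (K.eval x : ℂ) * ((bandCT μ 0 x : ℂ) - Complex.I * (fermiMatsubara β n : ℂ))⁻¹ with hdx
  set dy : ℂ := (1 : ℂ) - (K.eval y : ℂ) * ((bandCT μ 0 y : ℂ) - Complex.I * (fermiMatsubara β n : ℂ))⁻¹ with hdy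
  have hx := klso_dress_norm_le hβ μ K n x
  have hy := klso_dress_norm_le hβ μ K n y
  have hxy := klso_dress_sub_le hβ hK n x y
  have hB0 : 0 ≤ 1 + K.coeffNorm 0 * (β / Real.pi) := by
    have := TrigPolyC4v.coeffNorm_nonneg 0 K; positivity
  rw [sq_sub_sq, norm_mul]
  calc ‖dx + dy‖ * ‖dx - dy‖
      ≤ (‖dx‖ + ‖dy‖) * ‖dx - dy‖ := mul_le_mul_of_nonneg_right (norm_add_le _ _) (norm_nonneg _)
    _ ≤ ((1 + K.coeffNorm 0 * (β / Real.pi)) + (1 + K.coeffNorm 0 * (β / Real.pi))) *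
          (((4 + 7 * Real.sqrt 2) * (β / Real.pi) + K.coeffNorm 0 * (4 * β ^ 2 / π ^ 2)) * ‖x - y‖) :=
        mul_le_mul (add_le_add hx hy) hxy (norm_nonneg _) (by positivity)
    _ = _ := by ring

/-- Periodicity of the squared dressing symbol. -/
theorem klso_dressSq_periodic (β μ : ℝ) (K : TrigPolyC4v) (n : ℤ) (p : Fin 2 → ℝ) (m : Fin 2 → ℤ) :
    ((1 : ℂ) - (K.eval (fun i => p i + m i * (2 * Real.pi)) : ℂ) *
        ((bandCT μ 0 (fun i => p i + m i * (2 * Real.pi)) : ℂ) - Complex.I * (fermiMatsubara β n : ℂ))⁻¹) ^ 2 =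
      ((1 : ℂ) - (K.eval p : ℂ) * ((bandCT μ 0 p : ℂ) - Complex.I * (fermiMatsubara β n : ℂ))⁻¹) ^ 2 := by
  rw [klso_dress_periodic]

end Frame

/-! ## §3 Grid dictionary; the carrier's derivatives at `U = 0` in symbol form -/

section Model

variable {L M : ℕ} [NeZero L]

omit [NeZero L] in
/-- **The frame dressing at a grid point is the dressing symbol**: `ĝ₀(k)/ĝ_K(k) = 1 − K(p_k)·g₀(n,p_k)` (`β ≠ 0`). -/
theorem klso_propCT_div_eq_dress {β : ℝ} (hβ : β ≠ 0) (μ : ℝ) (K : TrigPolyC4v) (ω : MatsubaraIdx M) (k : TorusSite 2 L) :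
    propCT L M β μ 0 (ω, k) / propCT L M β μ K (ω, k) =
      1 - (K.eval (latticeMomentum L k) : ℂ) *
        ((bandCT μ 0 (latticeMomentum L k) : ℂ) - Complex.I * (fermiMatsubara β (matsubaraInt M ω) : ℂ))⁻¹ := by
  rw [← propCT_zero_eq_bareSymbol β μ ω k]
  have hg0 := propCT_ne_zero (L := L) (M := M) hβ μ 0 (ω, k)
  have hgK := propCT_ne_zero (L := L) (M := M) hβ μ K (ω, k)
  -- `1/ĝ_K = 1/ĝ₀ − K(p)`
  have hinv : (propCT L M β μ K (ω, k))⁻¹ = (propCT L M β μ 0 (ω, k))⁻¹ - (K.eval (latticeMomentum L k) : ℂ) := by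
    rw [propCT, propCT, one_div, one_div, inv_inv, inv_inv, nambuXiCT_zero_frame, nambuXi_eq_nambuXiCT_add L μ K k]
    push_cast
    ring
  rw [div_eq_mul_inv, hinv, mul_sub, mul_inv_cancel₀ hg0, mul_comm]

/-- **The ORDER-`U¹` coefficient in symbol form**: `d/dU|₀ Σ̂^K_{L,M}((ω,k),σ) = −d(n,p_k)² · t_{L,M}`,
`t_{L,M} = (βL²)⁻¹Σ_q ĝ₀(q)` (k3c5-p2's Hartree evaluation `hasDerivAt_klSelfEnergy_nScales_succ_zero_hartree`). -/
theorem klso_deriv_eq {β : ℝ} (hβ : 0 < β) (μ : ℝ) (K : TrigPolyC4v) (ω : MatsubaraIdx M) (k : TorusSite 2 L) (σ : Fin 2) :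
    deriv (fun U : ℝ => klSelfEnergy L M β U μ K klE0 (nScales β + 1) (ω, k) σ) 0 =
      -((1 - (K.eval (latticeMomentum L k) : ℂ) *
            ((bandCT μ 0 (latticeMomentum L k) : ℂ) - Complex.I * (fermiMatsubara β (matsubaraInt M ω) : ℂ))⁻¹) ^ 2) *
        ((∑ q : FreqMomentum L M, propCT L M β μ 0 q) / ((β * (L : ℝ) ^ 2 : ℝ) : ℂ)) := by
  rw [(hasDerivAt_klSelfEnergy_nScales_succ_zero_hartree hβ μ K (ω, k) σ).deriv, klso_propCT_div_eq_dress hβ.ne']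

/-- **The ORDER-`U²` coefficient in symbol form**:
`d²/dU²|₀ Σ̂^K_{L,M}((ω,k),σ) = 2·d(n,p_k)²·(klSunset L M β g₀ (ω,k) σ − g₀(n,p_k)·t² − t·t₂)`, `t₂ = (βL²)⁻¹Σ_q ĝ₀(q)²`
(k3c5-p3's `hasDerivAt_deriv_klSelfEnergy_nScales_succ_zero_eval` + `sunsetSum_div_eq_klSunset`). -/
theorem klso_deriv_deriv_eq {β : ℝ} (hβ : 0 < β) (μ : ℝ) (K : TrigPolyC4v) (ω : MatsubaraIdx M) (k : TorusSite 2 L) (σ : Fin 2) :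
    deriv (deriv fun U : ℝ => klSelfEnergy L M β U μ K klE0 (nScales β + 1) (ω, k) σ) 0 =
      2 * (1 - (K.eval (latticeMomentum L k) : ℂ) *
            ((bandCT μ 0 (latticeMomentum L k) : ℂ) - Complex.I * (fermiMatsubara β (matsubaraInt M ω) : ℂ))⁻¹) ^ 2 *
        (klSunset L M β (fun a x => ((bandCT μ 0 x : ℂ) - Complex.I * (fermiMatsubara β a : ℂ))⁻¹) (ω, k) σ -
          ((bandCT μ 0 (latticeMomentum L k) : ℂ) - Complex.I * (fermiMatsubara β (matsubaraInt M ω) : ℂ))⁻¹ *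
            ((∑ q : FreqMomentum L M, propCT L M β μ 0 q) / ((β * (L : ℝ) ^ 2 : ℝ) : ℂ)) ^ 2 -
          (∑ q : FreqMomentum L M, propCT L M β μ 0 q) / ((β * (L : ℝ) ^ 2 : ℝ) : ℂ) *
            ((∑ q : FreqMomentum L M, propCT L M β μ 0 q ^ 2) / ((β * (L : ℝ) ^ 2 : ℝ) : ℂ))) := by
  rw [(hasDerivAt_deriv_klSelfEnergy_nScales_succ_zero_eval hβ μ K (ω, k) σ).deriv, klso_propCT_div_eq_dress hβ.ne',
    ← sunsetSum_div_eq_klSunset β μ (ω, k) σ, propCT_zero_eq_bareSymbol β μ ω k]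
  have hβL : ((β * (L : ℝ) ^ 2 : ℝ) : ℂ) ≠ 0 := by
    have hL : (L : ℝ) ≠ 0 := by exact_mod_cast NeZero.ne L
    exact_mod_cast mul_ne_zero hβ.ne' (pow_ne_zero 2 hL)
  field_simp

end Model

end Summit.HubbardSuperconductivity.HubbardSuperconductivity.Theorems.KLRegimeSplit

end
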